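import Summits.BirchSwinnertonDyer.BirchSwinnertonDyer.Theorems.GenusKolyvaginAtTwoPowDvdShaCardAtTwoRTNonPhantomCocycleBasis
import HarnessLib

/-!
# Route `GenusKolyvaginAtTwo`, crux L_T `PowDvdShaCardAtTwoRT` (stmt-BirchSwinnertonDyer-23242), LINE 18 stub L, bottom rung:
# the NON-PHANTOM lemma (II) — a cocycle of `Γ ↠ GL₂(ℤ/4)` with values in `M[2]`, vanishing at the Tate
# transvection, is a coboundary

Seat `bsd-line-gk2-p3` g22 (PROVER 3/3, cell `bsd-f1-sign2`), `--supports stmt-BirchSwinnertonDyer-23242` (helper).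
THEOREMS ONLY (Mathlib + file (I), no definition, no named fact, no `sorry`). BSD is not proved by any of this; neither is
the crux. File 2 of 3.

THIS FILE: `NonPhantom.coboundary_of_two_torsion_values` — with basis data `P₁, P₂` (`4M = 0`, spanning, free mod `4`),
elements `u, ℓ, s, z, e₁ ∈ Γ` acting as `(1 1; 0 1)`, `(1 0; 1 1)`, `(0 1; 1 0)`, `−1`, `diag(−1, 1)`, and a cocycle `φ`
vanishing on the kernel of the action with `φ u = 0` and `2φ = 0`: `φ` is a coboundary.  PROOF (by hand, no `decide`):
(2) `φ` kills `u², ℓ², z, e₁, z e₁` (conjugation identities `u e₁ u⁻¹ ≡ e₁ u⁻²`, `ℓ e₁ ℓ⁻¹ ≡ e₁ ℓ⁻²` and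
`M^{u,ℓ} = 0`); (3) hence all of `V = ker(Γ → GL₂(𝔽₂))` by stripping the four parities of `v ≡ 1 + 2A`;
(4) averaging over `r = uℓ` (of order `3`) gives `φ₂ = φ − dm₃` with `φ₂ r = 0`, and the `S₃`-relation
`u r u⁻¹ ≡ r² (mod V)` forces `φ₂ u = 0` (`r²` has no fixed vector); (5) every `g` is `≡ 1, u, ℓ, r, r², ru (mod V)`
according to the parities of its matrix (the ten singular parity patterns contradict `P₁, P₂, P₁ − P₂ ∉ 2M`), so
`φ₂ = 0`.

References: T. Lawson, C. Wuthrich, *Vanishing of some Galois cohomology groups for elliptic curves*, in: Elliptic Curves,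
Modular Forms and Iwasawa Theory, Springer Proc. Math. Stat. 188 (2016), §7.1 and §8 [arXiv:1505.02940];
B. H. Gross, *Kolyvagin's work on modular elliptic curves* (1991), Prop. 9.1 (the odd-`p` injectivity whose `p = 2`
substitute this is); J.-P. Serre, *Abelian ℓ-adic representations* (1968), IV A.1.2 (Tate transvection).
-/

-- `Summit.<P>.<Sub>` repeats `BirchSwinnertonDyer` by the tree's layout convention (D-0017)
set_option linter.dupNamespace false
set_option autoImplicit false

namespace Summit.BirchSwinnertonDyer.BirchSwinnertonDyer.Theorems.GenusExact.NonPhantom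

variable {Γ : Type*} [Group Γ] {M : Type*} [AddCommGroup M] [DistribMulAction Γ M]

/-! ## §3 The core: cocycles with `2`-torsion values, then the `−1` trick, then the general statement -/

section Core

variable {P₁ P₂ : M}

/-- `(r²)` has no non-zero fixed vector when `r² : P₁ ↦ P₁ - P₂, P₂ ↦ 3P₁ + 2P₂` (`r = uℓ` of order `3`). [folklore] -/
theorem eq_zero_of_fixed_rr (hspan : ∀ m : M, ∃ a b : ℤ, m = a • P₁ + b • P₂)
    (hindep : ∀ a b : ℤ, a • P₁ + b • P₂ = 0 → (4 : ℤ) ∣ a ∧ (4 : ℤ) ∣ b)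
    (h4P₁ : (4 : ℤ) • P₁ = 0) (h4P₂ : (4 : ℤ) • P₂ = 0)
    {q : Γ} (hq₁ : q • P₁ = P₁ - P₂) (hq₂ : q • P₂ = (3 : ℤ) • P₁ + (2 : ℤ) • P₂)
    {x : M} (hx : q • x = x) : x = 0 := by
  obtain ⟨a, b, rfl⟩ := hspan x
  rw [smul_lincomb, hq₁, hq₂] at hx
  have h0 : (3 * b) • P₁ + (b - a) • P₂ = 0 := by
    have := sub_eq_zero.mpr hx
    have e : a • (P₁ - P₂) + b • ((3 : ℤ) • P₁ + (2 : ℤ) • P₂) - (a • P₁ + b • P₂) =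
        (3 * b) • P₁ + (b - a) • P₂ := by module
    rwa [e] at this
  obtain ⟨hb, ha⟩ := hindep _ _ h0
  rw [zsmul_eq_zero_of_four_dvd h4P₁ (by omega), zsmul_eq_zero_of_four_dvd h4P₂ (by omega), add_zero]

/-- **Core, values in `M[2]`.**  With the basis data, the elements `u, ℓ, s, z, e₁` (upper/lower transvection, swap,
`−1`, `diag(−1, 1)`) and a cocycle `φ` vanishing on the kernel of the action, with `φ u = 0` and `2φ = 0`:
`φ` is a coboundary.  Steps (2)–(5) of the module docstring. [cite: LawsonWuthrich2016, §8 (localisation kernel, `p = 2`,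
`dim M₂ = 4`)] -/
theorem coboundary_of_two_torsion_values (hM4 : ∀ m : M, (4 : ℤ) • m = 0)
    (hspan : ∀ m : M, ∃ a b : ℤ, m = a • P₁ + b • P₂)
    (hindep : ∀ a b : ℤ, a • P₁ + b • P₂ = 0 → (4 : ℤ) ∣ a ∧ (4 : ℤ) ∣ b)
    {u ℓ s z e₁ : Γ} (huP₁ : u • P₁ = P₁) (huP₂ : u • P₂ = P₁ + P₂)
    (hℓP₁ : ℓ • P₁ = P₁ + P₂) (hℓP₂ : ℓ • P₂ = P₂)
    (hsP₁ : s • P₁ = P₂) (hsP₂ : s • P₂ = P₁) (hz : ∀ m : M, z • m = -m)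
    (heP₁ : e₁ • P₁ = -P₁) (heP₂ : e₁ • P₂ = P₂)
    {φ : Γ → M} (hφ : ∀ g h, φ (g * h) = φ g + g • φ h)
    (hker : ∀ ρ : Γ, (∀ m : M, ρ • m = m) → φ ρ = 0) (hφu : φ u = 0)
    (h2φ : ∀ g, (2 : ℤ) • φ g = 0) :
    ∃ v : M, ∀ g, φ g = g • v - v := by
  have h4P₁ := hM4 P₁
  have h4P₂ := hM4 P₂
  -- inverse actions
  have huiP₁ : u⁻¹ • P₁ = P₁ := by rw [inv_smul_eq_iff, huP₁]
  have huiP₂ : u⁻¹ • P₂ = P₂ - P₁ := by rw [inv_smul_eq_iff, smul_sub, huP₁, huP₂]; abel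
  have hℓiP₁ : ℓ⁻¹ • P₁ = P₁ - P₂ := by rw [inv_smul_eq_iff, smul_sub, hℓP₁, hℓP₂]; abel
  have hℓiP₂ : ℓ⁻¹ • P₂ = P₂ := by rw [inv_smul_eq_iff, hℓP₂]
  have hsiP₁ : s⁻¹ • P₁ = P₂ := by rw [inv_smul_eq_iff, hsP₂]
  have hsiP₂ : s⁻¹ • P₂ = P₁ := by rw [inv_smul_eq_iff, hsP₁]
  -- `r = u ℓ`, of order `3`
  obtain ⟨r, hr⟩ : ∃ r : Γ, r = u * ℓ := ⟨_, rfl⟩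
  have hrP₁ : r • P₁ = (2 : ℤ) • P₁ + P₂ := by rw [hr, mul_smul, hℓP₁, smul_add, huP₁, huP₂]; abel
  have hrP₂ : r • P₂ = P₁ + P₂ := by rw [hr, mul_smul, hℓP₂, huP₂]
  have hr3P₁ : (r * r * r) • P₁ = P₁ := by
    rw [show (r * r * r) • P₁ = (13 : ℤ) • P₁ + (8 : ℤ) • P₂ by
      simp only [mul_smul, hrP₁, hrP₂, smul_add, smul_zsmul_comm]; module]
    rw [lincomb_congr h4P₁ h4P₂ (a' := 1) (b' := 0) (by norm_num) (by norm_num)]; module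
  have hr3P₂ : (r * r * r) • P₂ = P₂ := by
    rw [show (r * r * r) • P₂ = (8 : ℤ) • P₁ + (5 : ℤ) • P₂ by
      simp only [mul_smul, hrP₁, hrP₂, smul_add, smul_zsmul_comm]; module]
    rw [lincomb_congr h4P₁ h4P₂ (a' := 0) (b' := 1) (by norm_num) (by norm_num)]; module
  have hr3 : ∀ m : M, (r * r * r) • m = m := forall_smul_eq_self_of_basis hspan hr3P₁ hr3P₂
  have hri : ∀ m : M, r⁻¹ • m = (r * r) • m := fun m ↦ by
    rw [inv_smul_eq_iff, ← mul_smul, ← mul_assoc, hr3]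
  have hrri : ∀ m : M, (r * r)⁻¹ • m = r • m := fun m ↦ by
    rw [inv_smul_eq_iff, ← mul_smul, hr3]
  have hrrP₁ : (r * r) • P₁ = P₁ - P₂ := by
    rw [show (r * r) • P₁ = (5 : ℤ) • P₁ + (3 : ℤ) • P₂ by
      simp only [mul_smul, hrP₁, hrP₂, smul_add, smul_zsmul_comm]; module]
    rw [lincomb_congr h4P₁ h4P₂ (a' := 1) (b' := -1) (by norm_num) (by norm_num)]; module
  have hrrP₂ : (r * r) • P₂ = (3 : ℤ) • P₁ + (2 : ℤ) • P₂ := by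
    simp only [mul_smul, hrP₁, hrP₂, smul_add]; module
  -- elements `≡ 1 (mod 2)` fix `M[2]`
  have fixD : ∀ (v : Γ) (α β γ δ : ℤ), v • P₁ = (1 + 2 * α) • P₁ + (2 * γ) • P₂ →
      v • P₂ = (2 * β) • P₁ + (1 + 2 * δ) • P₂ → ∀ x : M, (2 : ℤ) • x = 0 → v • x = x :=
    fun v α β γ δ h₁ h₂ x hx ↦ smul_eq_self_of_congr_one hM4 hspan hindep (y₁ := α • P₁ + γ • P₂)
      (y₂ := β • P₁ + δ • P₂) (by rw [h₁]; module) (by rw [h₂]; module) hx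
  ------------------------------------------------------------------------------------------------
  -- Step 2: `φ` kills `u², z, ℓ², e₁, z e₁`
  have hn₁ : φ (u * u) = 0 := by rw [cocycle_mul_of_eq_zero_left hφ hφu, hφu, smul_zero]
  have hφz : φ z = 0 := by
    have hfix : ∀ g : Γ, g • φ z = φ z := by
      intro g
      have hcomm : ∀ m : M, (g * z) • m = (z * g) • m := fun m ↦ by
        rw [mul_smul, mul_smul, hz, hz, smul_neg]
      have h := cocycle_eq_of_forall_smul_eq hφ hker hcomm
      rw [hφ, hφ, hz] at h
      -- `h : φ g + g • φ z = φ z + -φ g`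
      have h2 : φ g + φ g = 0 := by rw [← two_zsmul]; exact h2φ g
      have e : g • φ z - φ z = -(φ g + φ g) := by
        rw [← sub_eq_zero]
        have : g • φ z - φ z - -(φ g + φ g) = (φ g + g • φ z) - (φ z + -φ g) := by abel
        rw [this, h, sub_self]
      rw [h2, neg_zero, sub_eq_zero] at e
      exact e
    exact eq_zero_of_fixed_transvections hspan hindep h4P₁ h4P₂ huP₁ huP₂ hℓP₁ hℓP₂ (hfix u) (hfix ℓ)
  have hn₂ : φ (ℓ * ℓ) = 0 := by
    have hact : ∀ m : M, (ℓ * ℓ) • m = (s * (u * u) * s⁻¹) • m :=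
      forall_smul_eq_of_basis hspan
        (by simp only [mul_smul, hℓP₁, hℓP₂, hsiP₁, huP₁, huP₂, hsP₁, hsP₂, smul_add]; abel)
        (by simp only [mul_smul, hℓP₂, hsiP₂, huP₁, hsP₁])
    have hV : (s * (u * u) * s⁻¹) • φ s = φ s :=
      fixD _ 0 0 1 0 (by simp only [mul_smul, hsiP₁, huP₂, smul_add, huP₁, hsP₁, hsP₂]; module)
        (by simp only [mul_smul, hsiP₂, huP₁, hsP₁]; module) _ (h2φ s)
    rw [cocycle_eq_of_forall_smul_eq hφ hker hact, cocycle_conj hφ, hn₁, smul_zero, add_zero, hV, sub_self]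
  have hφe₁ : φ e₁ = 0 := by
    have h2x : (2 : ℤ) • φ e₁ = 0 := h2φ e₁
    -- (i) `u` fixes `φ e₁`: `u e₁ u⁻¹ ≡ e₁ (uu)⁻¹`
    have hux : u • φ e₁ = φ e₁ := by
      have h1 : φ (u * e₁ * u⁻¹) = u • φ e₁ := by
        rw [cocycle_conj hφ, hφu, smul_zero, zero_add, sub_zero]
      have hact : ∀ m : M, (u * e₁ * u⁻¹) • m = (e₁ * (u * u)⁻¹) • m :=
        forall_smul_eq_of_basis hspan
          (by simp only [mul_smul, mul_inv_rev, huiP₁, heP₁, smul_neg, huP₁])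
          (by simp only [mul_smul, mul_inv_rev, huiP₂, smul_sub, heP₁, heP₂, huiP₁, huP₁, huP₂,
                smul_neg]; abel)
      have h2 : φ (e₁ * (u * u)⁻¹) = φ e₁ := by
        rw [hφ, cocycle_inv hφ, hn₁, smul_zero, neg_zero, smul_zero, add_zero]
      rw [← h1, cocycle_eq_of_forall_smul_eq hφ hker hact, h2]
    -- (ii) `ℓ` fixes `φ e₁`: `ℓ e₁ ℓ⁻¹ ≡ e₁ (ℓℓ)⁻¹`
    have hℓx : ℓ • φ e₁ = φ e₁ := by
      have hV : (ℓ * e₁ * ℓ⁻¹) • φ ℓ = φ ℓ :=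
        fixD _ (-1) 0 (-1) 0
          (by simp only [mul_smul, hℓiP₁, smul_sub, heP₁, heP₂, hℓP₁, hℓP₂, smul_neg]; module)
          (by simp only [mul_smul, hℓiP₂, heP₂, hℓP₂]; module) _ (h2φ ℓ)
      have h1 : φ (ℓ * e₁ * ℓ⁻¹) = ℓ • φ e₁ := by
        rw [cocycle_conj hφ, hV]; abel
      have hact : ∀ m : M, (ℓ * e₁ * ℓ⁻¹) • m = (e₁ * (ℓ * ℓ)⁻¹) • m :=
        forall_smul_eq_of_basis hspan
          (by simp only [mul_smul, mul_inv_rev, hℓiP₁, smul_sub, heP₁, heP₂, hℓP₁, hℓP₂, hℓiP₂,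
                smul_neg]; abel)
          (by simp only [mul_smul, mul_inv_rev, hℓiP₂, heP₂, hℓP₂])
      have h2 : φ (e₁ * (ℓ * ℓ)⁻¹) = φ e₁ := by
        rw [hφ, cocycle_inv hφ, hn₂, smul_zero, neg_zero, smul_zero, add_zero]
      rw [← h1, cocycle_eq_of_forall_smul_eq hφ hker hact, h2]
    exact eq_zero_of_fixed_transvections hspan hindep h4P₁ h4P₂ huP₁ huP₂ hℓP₁ hℓP₂ hux hℓx
  have hφe₂ : φ (z * e₁) = 0 := by rw [cocycle_mul_of_eq_zero_left hφ hφz, hφe₁, smul_zero]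
  ------------------------------------------------------------------------------------------------
  -- Step 3: `φ` vanishes on `V = ker (Γ → GL₂(𝔽₂))`, by stripping parities
  have key : ∀ (v : Γ) (α β γ δ : ℤ), v • P₁ = (1 + 2 * α) • P₁ + (2 * γ) • P₂ →
      v • P₂ = (2 * β) • P₁ + (1 + 2 * δ) • P₂ → (2 : ℤ) ∣ α → (2 : ℤ) ∣ β → (2 : ℤ) ∣ γ → (2 : ℤ) ∣ δ →
      φ v = 0 := by
    intro v α β γ δ h₁ h₂ hα hβ hγ hδ
    apply hker
    apply forall_smul_eq_self_of_basis hspan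
    · rw [h₁, lincomb_congr h4P₁ h4P₂ (a' := 1) (b' := 0) (by omega) (by omega)]; module
    · rw [h₂, lincomb_congr h4P₁ h4P₂ (a' := 0) (b' := 1) (by omega) (by omega)]; module
  have sδ : ∀ (v : Γ) (α β γ δ : ℤ), v • P₁ = (1 + 2 * α) • P₁ + (2 * γ) • P₂ →
      v • P₂ = (2 * β) • P₁ + (1 + 2 * δ) • P₂ → (2 : ℤ) ∣ α → (2 : ℤ) ∣ β → (2 : ℤ) ∣ γ → φ v = 0 := by
    intro v α β γ δ h₁ h₂ hα hβ hγ
    by_cases hδ : (2 : ℤ) ∣ δ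
    · exact key v α β γ δ h₁ h₂ hα hβ hγ hδ
    rw [← cocycle_mul_of_eq_zero_right hφ hφe₂]
    refine key (v * (z * e₁)) α β γ (δ + 1) ?_ ?_ hα hβ hγ (by omega)
    · rw [mul_smul, mul_smul, heP₁, hz, neg_neg, h₁]
    · rw [mul_smul, mul_smul, heP₂, hz, smul_neg, h₂,
        show -((2 * β) • P₁ + (1 + 2 * δ) • P₂) = (-(2 * β)) • P₁ + (-(1 + 2 * δ)) • P₂ by module]
      exact lincomb_congr h4P₁ h4P₂ (by omega) (by omega)
  have sγ : ∀ (v : Γ) (α β γ δ : ℤ), v • P₁ = (1 + 2 * α) • P₁ + (2 * γ) • P₂ →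
      v • P₂ = (2 * β) • P₁ + (1 + 2 * δ) • P₂ → (2 : ℤ) ∣ α → (2 : ℤ) ∣ β → φ v = 0 := by
    intro v α β γ δ h₁ h₂ hα hβ
    by_cases hγ : (2 : ℤ) ∣ γ
    · exact sδ v α β γ δ h₁ h₂ hα hβ hγ
    rw [← cocycle_mul_of_eq_zero_right hφ hn₂]
    refine sδ (v * (ℓ * ℓ)) α β (γ + 1) δ ?_ ?_ hα hβ (by omega)
    · rw [show (v * (ℓ * ℓ)) • P₁ = (1 + 2 * α + 4 * β) • P₁ + (2 * γ + 2 + 4 * δ) • P₂ by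
        simp only [mul_smul, hℓP₁, hℓP₂, smul_add, h₁, h₂]; module]
      exact lincomb_congr h4P₁ h4P₂ (by omega) (by omega)
    · simp only [mul_smul, hℓP₂, h₂]
  have sβ : ∀ (v : Γ) (α β γ δ : ℤ), v • P₁ = (1 + 2 * α) • P₁ + (2 * γ) • P₂ →
      v • P₂ = (2 * β) • P₁ + (1 + 2 * δ) • P₂ → (2 : ℤ) ∣ α → φ v = 0 := by
    intro v α β γ δ h₁ h₂ hα
    by_cases hβ : (2 : ℤ) ∣ β
    · exact sγ v α β γ δ h₁ h₂ hα hβ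
    rw [← cocycle_mul_of_eq_zero_right hφ hn₁]
    refine sγ (v * (u * u)) α (β + 1) γ δ ?_ ?_ hα (by omega)
    · simp only [mul_smul, huP₁, h₁]
    · rw [show (v * (u * u)) • P₂ = (2 + 4 * α + 2 * β) • P₁ + (4 * γ + 1 + 2 * δ) • P₂ by
        simp only [mul_smul, huP₁, huP₂, smul_add, h₁, h₂]; module]
      exact lincomb_congr h4P₁ h4P₂ (by omega) (by omega)
  have hV : ∀ (v : Γ) (α β γ δ : ℤ), v • P₁ = (1 + 2 * α) • P₁ + (2 * γ) • P₂ →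
      v • P₂ = (2 * β) • P₁ + (1 + 2 * δ) • P₂ → φ v = 0 := by
    intro v α β γ δ h₁ h₂
    by_cases hα : (2 : ℤ) ∣ α
    · exact sβ v α β γ δ h₁ h₂ hα
    rw [← cocycle_mul_of_eq_zero_right hφ hφe₁]
    refine sβ (v * e₁) (α + 1) β γ δ ?_ ?_ (by omega)
    · rw [mul_smul, heP₁, smul_neg, h₁,
        show -((1 + 2 * α) • P₁ + (2 * γ) • P₂) = (-(1 + 2 * α)) • P₁ + (-(2 * γ)) • P₂ by module]
      exact lincomb_congr h4P₁ h4P₂ (by omega) (by omega)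
    · rw [mul_smul, heP₂, h₂]
  ------------------------------------------------------------------------------------------------
  -- Step 4: average over `r`; `φ₂ := φ - d m₃` kills `r`, `V`, and then `u`, `ℓ`
  have hφr3 : φ (r * r * r) = 0 := hker _ hr3
  have e1 : r • φ r = φ (r * r) - φ r := by rw [eq_sub_iff_add_eq, add_comm, ← hφ]
  have e2 : r • φ (r * r) = -φ r := by
    have := hφ r (r * r)
    rw [← mul_assoc, hφr3] at this
    rw [eq_neg_iff_add_eq_zero, add_comm]
    exact this.symm
  obtain ⟨m₃, hm₃⟩ : ∃ m₃ : M, m₃ = φ r + φ (r * r) := ⟨_, rfl⟩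
  have h2m₃ : (2 : ℤ) • m₃ = 0 := by rw [hm₃, smul_add, h2φ, h2φ, add_zero]
  obtain ⟨φ₂, hφ₂def⟩ : ∃ φ₂ : Γ → M, φ₂ = fun g ↦ φ g - (g • m₃ - m₃) := ⟨_, rfl⟩
  have hφ₂ : ∀ g h, φ₂ (g * h) = φ₂ g + g • φ₂ h := by
    rw [hφ₂def]; exact cocycle_sub_coboundary hφ m₃
  have hφ₂app : ∀ g, φ₂ g = φ g - (g • m₃ - m₃) := fun g ↦ by rw [hφ₂def]
  have hφ₂r : φ₂ r = 0 := by
    rw [hφ₂app, hm₃, smul_add, e1, e2,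
      show φ r - (φ (r * r) - φ r + -φ r - (φ r + φ (r * r))) = (4 : ℤ) • φ r by module, hM4]
  have h2φ₂ : ∀ g, (2 : ℤ) • φ₂ g = 0 := fun g ↦ by
    rw [hφ₂app, smul_sub, smul_sub, ← smul_zsmul_comm, h2m₃, h2φ, smul_zero, sub_self, sub_zero]
  have hV₂ : ∀ (v : Γ) (α β γ δ : ℤ), v • P₁ = (1 + 2 * α) • P₁ + (2 * γ) • P₂ →
      v • P₂ = (2 * β) • P₁ + (1 + 2 * δ) • P₂ → φ₂ v = 0 := by
    intro v α β γ δ h₁ h₂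
    rw [hφ₂app, hV v α β γ δ h₁ h₂, fixD v α β γ δ h₁ h₂ m₃ h2m₃, sub_self, sub_zero]
  -- parity form of the `V`-vanishing and of the `M[2]`-fixing
  have hV₂' : ∀ (v : Γ) (A B C D : ℤ), v • P₁ = A • P₁ + C • P₂ → v • P₂ = B • P₁ + D • P₂ →
      A % 2 = 1 → B % 2 = 0 → C % 2 = 0 → D % 2 = 1 → φ₂ v = 0 := by
    intro v A B C D h₁ h₂ hA hB hC hD
    obtain ⟨α, rfl⟩ : ∃ α, A = 1 + 2 * α := ⟨(A - 1) / 2, by omega⟩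
    obtain ⟨β, rfl⟩ : ∃ β, B = 2 * β := ⟨B / 2, by omega⟩
    obtain ⟨γ, rfl⟩ : ∃ γ, C = 2 * γ := ⟨C / 2, by omega⟩
    obtain ⟨δ, rfl⟩ : ∃ δ, D = 1 + 2 * δ := ⟨(D - 1) / 2, by omega⟩
    exact hV₂ v α β γ δ h₁ h₂
  have fixD' : ∀ (v : Γ) (A B C D : ℤ), v • P₁ = A • P₁ + C • P₂ → v • P₂ = B • P₁ + D • P₂ →
      A % 2 = 1 → B % 2 = 0 → C % 2 = 0 → D % 2 = 1 → ∀ x : M, (2 : ℤ) • x = 0 → v • x = x := by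
    intro v A B C D h₁ h₂ hA hB hC hD
    obtain ⟨α, rfl⟩ : ∃ α, A = 1 + 2 * α := ⟨(A - 1) / 2, by omega⟩
    obtain ⟨β, rfl⟩ : ∃ β, B = 2 * β := ⟨B / 2, by omega⟩
    obtain ⟨γ, rfl⟩ : ∃ γ, C = 2 * γ := ⟨C / 2, by omega⟩
    obtain ⟨δ, rfl⟩ : ∃ δ, D = 1 + 2 * δ := ⟨(D - 1) / 2, by omega⟩
    exact fixD v α β γ δ h₁ h₂
  -- `φ₂ u = 0` from the `S₃`-relation `u r u⁻¹ ≡ r² (mod V)`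
  have hφ₂u : φ₂ u = 0 := by
    have hd₁ : ((r * r)⁻¹ * (u * r * u⁻¹)) • P₁ = (7 : ℤ) • P₁ + (4 : ℤ) • P₂ := by
      simp only [mul_smul, hrri, huiP₁, hrP₁, hrP₂, huP₁, huP₂, smul_add, smul_zsmul_comm]
      module
    have hd₂ : ((r * r)⁻¹ * (u * r * u⁻¹)) • P₂ = (-2 : ℤ) • P₁ + (-1 : ℤ) • P₂ := by
      simp only [mul_smul, hrri, huiP₂, smul_sub, hrP₁, hrP₂, huP₁, huP₂, smul_add, smul_zsmul_comm]
      module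
    have hv₀ : φ₂ ((r * r)⁻¹ * (u * r * u⁻¹)) = 0 :=
      hV₂' _ _ _ _ _ hd₁ hd₂ (by norm_num) (by norm_num) (by norm_num) (by norm_num)
    have hsplit : u * r * u⁻¹ = (r * r) * ((r * r)⁻¹ * (u * r * u⁻¹)) := by rw [mul_inv_cancel_left]
    have hrr : φ₂ (r * r) = 0 := by rw [hφ₂, hφ₂r, smul_zero, add_zero]
    have hzero : φ₂ (u * r * u⁻¹) = 0 := by rw [hsplit, hφ₂ (r * r), hv₀, smul_zero, add_zero, hrr]
    have hconj : φ₂ (u * r * u⁻¹) = φ₂ u - (u * r * u⁻¹) • φ₂ u := by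
      rw [cocycle_conj hφ₂, hφ₂r, smul_zero, add_zero]
    have hv₀y : ((r * r)⁻¹ * (u * r * u⁻¹)) • φ₂ u = φ₂ u :=
      fixD' _ _ _ _ _ hd₁ hd₂ (by norm_num) (by norm_num) (by norm_num) (by norm_num) _ (h2φ₂ u)
    rw [hzero, hsplit, mul_smul, hv₀y, eq_comm, sub_eq_zero, eq_comm] at hconj
    exact eq_zero_of_fixed_rr hspan hindep h4P₁ h4P₂ hrrP₁ hrrP₂ hconj
  have hφ₂ℓ : φ₂ ℓ = 0 := by
    rw [show ℓ = u⁻¹ * r by rw [hr, inv_mul_cancel_left], hφ₂, hφ₂r, smul_zero, add_zero,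
      cocycle_inv hφ₂, hφ₂u, smul_zero, neg_zero]
  have hφ₂rr : φ₂ (r * r) = 0 := by rw [hφ₂, hφ₂r, smul_zero, add_zero]
  have hφ₂ru : φ₂ (r * u) = 0 := by rw [hφ₂, hφ₂r, hφ₂u, smul_zero, add_zero]
  ------------------------------------------------------------------------------------------------
  -- Step 5: every `g` is `≡ 1, u, ℓ, r, r², ru (mod V)`
  have hall : ∀ g, φ₂ g = 0 := by
    intro g
    obtain ⟨a, c, hg₁⟩ := hspan (g • P₁)
    obtain ⟨b, d, hg₂⟩ := hspan (g • P₂)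
    have dead₁ : (2 : ℤ) ∣ a → (2 : ℤ) ∣ c → False := fun ha hc ↦ by
      obtain ⟨α, rfl⟩ := ha
      obtain ⟨γ, rfl⟩ := hc
      obtain ⟨y, hy⟩ := exists_eq_two_smul_of_smul_eq g (x := P₁) (y := α • P₁ + γ • P₂) (by rw [hg₁]; module)
      exact basis_fst_ne_two_smul hspan hindep y hy
    have dead₂ : (2 : ℤ) ∣ b → (2 : ℤ) ∣ d → False := fun hb hd ↦ by
      obtain ⟨β, rfl⟩ := hb
      obtain ⟨δ, rfl⟩ := hd
      obtain ⟨y, hy⟩ := exists_eq_two_smul_of_smul_eq g (x := P₂) (y := β • P₁ + δ • P₂) (by rw [hg₂]; module)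
      exact basis_snd_ne_two_smul hspan hindep y hy
    have dead₃ : (2 : ℤ) ∣ a - b → (2 : ℤ) ∣ c - d → False := fun hab hcd ↦ by
      obtain ⟨α, hα⟩ := hab
      obtain ⟨γ, hγ⟩ := hcd
      obtain rfl : a = b + 2 * α := by omega
      obtain rfl : c = d + 2 * γ := by omega
      obtain ⟨y, hy⟩ := exists_eq_two_smul_of_smul_eq g (x := P₁ - P₂) (y := α • P₁ + γ • P₂)
        (by rw [smul_sub, hg₁, hg₂]; module)
      exact basis_sub_ne_two_smul hspan hindep y hy
    have live : ∀ w : Γ, φ₂ w = 0 → ∀ A B C D : ℤ, (w⁻¹ * g) • P₁ = A • P₁ + C • P₂ →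
        (w⁻¹ * g) • P₂ = B • P₁ + D • P₂ → A % 2 = 1 → B % 2 = 0 → C % 2 = 0 → D % 2 = 1 → φ₂ g = 0 := by
      intro w hw A B C D h₁ h₂ hA hB hC hD
      rw [show g = w * (w⁻¹ * g) by rw [mul_inv_cancel_left], cocycle_mul_of_eq_zero_left hφ₂ hw,
        hV₂' _ A B C D h₁ h₂ hA hB hC hD, smul_zero]
    rcases Int.emod_two_eq_zero_or_one a with ha | ha <;>
    rcases Int.emod_two_eq_zero_or_one b with hb | hb <;>
    rcases Int.emod_two_eq_zero_or_one c with hc | hc <;>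
    rcases Int.emod_two_eq_zero_or_one d with hd | hd
    · exact (dead₁ (by omega) (by omega)).elim
    · exact (dead₁ (by omega) (by omega)).elim
    · exact (dead₂ (by omega) (by omega)).elim
    · exact (dead₃ (by omega) (by omega)).elim
    · exact (dead₁ (by omega) (by omega)).elim
    · exact (dead₁ (by omega) (by omega)).elim
    · -- `ḡ = (0 1; 1 0) = r̄ ū`
      refine live (r * u) hφ₂ru (2 * a + c) (2 * b + d) (3 * a + 2 * c) (3 * b + 2 * d) ?_ ?_
        (by omega) (by omega) (by omega) (by omega)
      · simp only [mul_smul, mul_inv_rev, hri, hg₁, smul_add, smul_zsmul_comm, hrP₁, hrP₂, huiP₁, huiP₂,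
          smul_sub]; module
      · simp only [mul_smul, mul_inv_rev, hri, hg₂, smul_add, smul_zsmul_comm, hrP₁, hrP₂, huiP₁, huiP₂,
          smul_sub]; module
    · -- `ḡ = (0 1; 1 1) = r̄`
      refine live r hφ₂r (5 * a + 3 * c) (5 * b + 3 * d) (3 * a + 2 * c) (3 * b + 2 * d) ?_ ?_
        (by omega) (by omega) (by omega) (by omega)
      · simp only [mul_smul, hri, hg₁, smul_add, smul_zsmul_comm, hrP₁, hrP₂]; module
      · simp only [mul_smul, hri, hg₂, smul_add, smul_zsmul_comm, hrP₁, hrP₂]; module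
    · exact (dead₂ (by omega) (by omega)).elim
    · -- `ḡ = 1`
      refine live 1 (cocycle_one hφ₂) a b c d ?_ ?_ (by omega) (by omega) (by omega) (by omega)
      · rw [inv_one, one_mul, hg₁]
      · rw [inv_one, one_mul, hg₂]
    · exact (dead₂ (by omega) (by omega)).elim
    · -- `ḡ = (1 0; 1 1) = ℓ̄`
      refine live ℓ hφ₂ℓ a b (c - a) (d - b) ?_ ?_ (by omega) (by omega) (by omega) (by omega)
      · simp only [mul_smul, hg₁, smul_add, smul_zsmul_comm, hℓiP₁, hℓiP₂, smul_sub]; module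
      · simp only [mul_smul, hg₂, smul_add, smul_zsmul_comm, hℓiP₁, hℓiP₂, smul_sub]; module
    · exact (dead₃ (by omega) (by omega)).elim
    · -- `ḡ = (1 1; 0 1) = ū`
      refine live u hφ₂u (a - c) (b - d) c d ?_ ?_ (by omega) (by omega) (by omega) (by omega)
      · simp only [mul_smul, hg₁, smul_add, smul_zsmul_comm, huiP₁, huiP₂, smul_sub]; module
      · simp only [mul_smul, hg₂, smul_add, smul_zsmul_comm, huiP₁, huiP₂, smul_sub]; module
    · -- `ḡ = (1 1; 1 0) = r̄²`
      refine live (r * r) hφ₂rr (2 * a + c) (2 * b + d) (a + c) (b + d) ?_ ?_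
        (by omega) (by omega) (by omega) (by omega)
      · simp only [mul_smul, hrri, hg₁, smul_add, smul_zsmul_comm, hrP₁, hrP₂]; module
      · simp only [mul_smul, hrri, hg₂, smul_add, smul_zsmul_comm, hrP₁, hrP₂]; module
    · exact (dead₃ (by omega) (by omega)).elim
  refine ⟨m₃, fun g ↦ ?_⟩
  have := hall g
  rwa [hφ₂app, sub_eq_zero] at this

end Core

end Summit.BirchSwinnertonDyer.BirchSwinnertonDyer.Theorems.GenusExact.NonPhantom
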